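import Mathlib.GroupTheory.FreeGroup.Basic
import Mathlib.GroupTheory.Abelianization.Defs
import Mathlib.GroupTheory.Perm.Basic
import Mathlib.Logic.Equiv.Basic
import Mathlib.Logic.Relation
import Mathlib.Data.List.FinRange
import Literature.Topology.FourManifolds.BalancedPresentation
import HarnessLib

/-!
# Signed planar word calculus: arc data of `Mod(D_n, ∂)`, planar curves, achiral words and their moves (definitions only)

Topic `Literature/Topology/FourManifolds` (combinatorial encoding of planar (achiral) Lefschetz
fibrations / planar open books; general mathematics, no named facts, nothing asserted).  Written for
the proof line `seam-walk-one-sided-ball` of the crux `ConvexBisection.PlanarBisectionRigidity`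
(item stmt-SmoothPoincare4-10511), whose registered skeleton
`Summits/…/Cruxes/PlanarBisectionRigidity/Lines/seam-walk-one-sided-ball.lean` §1 these
definitions reproduce VERBATIM in statement (same names, fields and bodies), so that the registered
stub signatures resolve unchanged after `open Literature.Topology.FourManifolds.PlanarWords`

Definitions file (`Theorems/<RouteSlug>Defs.lean`, CONVENTIONS §1: objects a route posits) of the
proof line `seam-walk-one-sided-ball` for the crux `ConvexBisection.PlanarBisectionRigidity`
(item stmt-SmoothPoincare4-10511, route route-SmoothPoincare4-ConvexBisection; registered
skeleton `Cruxes/PlanarBisectionRigidity/Lines/seam-walk-one-sided-ball.lean`, §1, whose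
definitions are copied here VERBATIM in statement — same names, fields and bodies).  It carries
ONLY the objects the line posits, so that the registered stubs `stub_wendlDictionary` and
`stub_seamWalk` (whose signatures mention `PlanarCurve`, `IsIntegralSphereWord`, `Reachable`,
`blockForm`, `SeamTrivial`, `TwistEq`) and every file serving them refer to the same
declarations, after `open Literature.Topology.FourManifolds.PlanarWords`.

## Content

* ARC DATA (`ArcData`, `ArcData.aut/one/mul`).  The page is the disc `D_n` with `n` holes
  `0, …, n−1` (left to right), outer boundary `∂₀`, base point `p₀ ∈ ∂₀`, disjoint arcs `δᵢ` from
  `p₀` to the hole `i`, free generators `xᵢ = δᵢ ∂ᵢ δᵢ⁻¹` of `π₁(D_n, p₀) = F_n`.  A mapping class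
  `φ ∈ Mod(D_n, ∂₀)` fixing `∂₀` pointwise and permuting the holes without rotating them is recorded
  FAITHFULLY by its arc data `(π, u)`, `φ(δᵢ) ≃ uᵢ · δ_{π i}` — this is the Alexander method
  (a mapping class of a surface with boundary is determined by its action on a filling system of
  arcs; Farb–Margalit, *A Primer on Mapping Class Groups* (2012), §2.3, Prop. 2.8, bib key
  `FarbMargalit2012`).  It induces `xᵢ ↦ uᵢ x_{π i} uᵢ⁻¹` on `F_n` and composes by
  `u^{φψ}ᵢ = φ_*(u^ψᵢ) · u^φ_{π_ψ i}`; the seam group of the planar open book `OB(D_n, φ)` is the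
  BALANCED presentation `⟨x₀ … x_{n−1} ∣ u₀(φ), …, u_{n−1}(φ)⟩` (mapping torus + binding meridians),
  typed through the tree's `Literature.Topology.FourManifolds.BalancedPresentation`.
* GENERATORS (`PGen`, `PGen.inv/below/blockWord/data`, `evalWord`, `invWord`): the non-rotating
  half-twists `σⱼ` (Artin action `xⱼ ↦ xⱼ xⱼ₊₁ xⱼ⁻¹`, `xⱼ₊₁ ↦ xⱼ`; arc data `uⱼ = xⱼ`) and the
  Dehn twists `T_[a,b]` about the ROUND curve enclosing the consecutive holes `a … b` (arc data
  `uᵢ = x_a ⋯ x_b` for `a ≤ i ≤ b`); words act by `foldr` (the LAST letter acts first).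
* CURVES AND SIGNED WORDS (`PlanarCurve`, `PlanarCurve.twistWord/cls/image/InRange`, `Letter`,
  `Letter.twistWord`, `monodromy`, `positiveWord`, `blockForm`): every simple closed curve is
  `g(c_[a,b])` for a word `g`, its twist is `g T_[a,b] g⁻¹`; an achiral planar Lefschetz fibration
  over the disc with planar page is a word of signed letters (Gompf–Stipsicz, *4-Manifolds and Kirby
  Calculus* (1999) §8.2, bib key `GompfStipsiczGSM1999`; Baykur, *Kähler decomposition of
  4-manifolds*, AGT 6 (2006) = arXiv:math/0601396, Thm 5.1, bib key `Baykur2006`); the block form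
  `A · B̄ʳᵉᵛ` is the achiral word of the planar bisection `X_A ∪ X̄_B`.
* INVARIANTS (`SeamTrivial`, `NormallyGenerates`, `Unimodular`, `IsIntegralSphereWord`): trivial
  seam group of the positive block; `π₁(X_A ∪ X̄_B) = 1`; unimodular hole-set matrices; and the
  bundled notion of an INTEGRAL HOMOTOPY-SPHERE WORD `(n; A, B)`.
* MOVES (`hurwitzAct`, `Move`, `Reachable`, `TwistEq`): rotation, the signed Hurwitz move and its
  inverse, global conjugation, planar (de)stabilisation; `Reachable` is the equivalence relation
  they generate; `TwistEq n A B` is the walk's semantic double target (letterwise equal positive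
  twists, i.e. equal arc data, independent of the spelling of the carrying words; skeleton v3).
* Seven definitional sanity lemmas (`evalWord_nil`, `PGen.inv_inv`, `invWord_invWord`,
  `Reachable.refl`, `Reachable.symm`, `Move.reachable`, `TwistEq.refl`) — `rfl`/`simp`-level
  bookkeeping only.

## What is NOT here (design)

NOTHING is asserted about topology: this file is definitions plus definitional lemmas.  No
statement relating arc data to diffeomorphisms (faithfulness of the Alexander method), no braid,
lantern or chain relation, and no dictionary between words and Stein bisections is proved or
postulated here — those are the registered stubs of the line, landed in their own files.  The
conventions (composition order, chirality, the arc data of `σⱼ^{±1}` and `T_[a,b]^{±1}`, the Hurwitz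
move `(x, y) ↦ (x y x⁻¹, x)`) were validated EXTERNALLY by the lead's Python twin of these very
definitions (`work/engine/arcdata.py --selftest` in the line folder: `σⱼσⱼ⁻¹ = 1`, the braid
relations for `n ≤ 5`, commutation of `T_[a,b]` with interior/disjoint `σⱼ` and with nested/disjoint
round twists, the full-twist identity `(σ₀⋯σ_{n−2})ⁿ = T_[0,n−1] ∏ T_[i,i]⁻¹`, the LANTERN relation
on `D₃`, trivial seam groups of nested words and seam group `ℤ/m` of `(annulus, Tᵐ)`).  The
chirality and product-order conventions are immaterial for the truth of the stubs (reflection of the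
disc and reversal of words transport one convention to the other).  The file deliberately does not
import the route's Theses file: the vocabulary does not depend on the problem statement.
-/

noncomputable section

namespace Literature.Topology.FourManifolds.PlanarWords

/-- ARC DATA of a (hole-permuting, non-rotating, `∂₀`-fixing) mapping class of the disc with `n` holes:
the permutation `π` of the holes and the words `uᵢ = [φ(δᵢ) · δ_{π i}⁻¹] ∈ F_n`. [folklore] -/
structure ArcData (n : ℕ) where
  /-- the permutation of the holes -/
  perm : Equiv.Perm (Fin n)
  /-- the arc words `uᵢ` -/
  u : Fin n → FreeGroup (Fin n)

namespace ArcData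

variable {n : ℕ}

/-- The induced automorphism of `F_n = π₁(D_n, p₀)`: `xᵢ ↦ uᵢ · x_{π i} · uᵢ⁻¹`. [folklore] -/
def aut (φ : ArcData n) : FreeGroup (Fin n) →* FreeGroup (Fin n) :=
  FreeGroup.lift fun i => φ.u i * FreeGroup.of (φ.perm i) * (φ.u i)⁻¹

/-- The identity mapping class. [folklore] -/
def one : ArcData n := ⟨1, fun _ => 1⟩

/-- Composition `φ ∘ ψ` (`ψ` first): `π = π_φ π_ψ`, `uᵢ = φ_*(u^ψᵢ) · u^φ_{π_ψ i}`. [folklore] -/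
def mul (φ ψ : ArcData n) : ArcData n :=
  ⟨φ.perm * ψ.perm, fun i => φ.aut (ψ.u i) * φ.u (ψ.perm i)⟩

end ArcData

/-- GENERATORS of the framed braid group of the holed disc, as hole-index syntax independent of `n`:
`sigma j inv` = the half-twist `σⱼ^{±1}` exchanging holes `j`, `j+1`; `round a b inv` = the Dehn twist
`T_[a,b]^{±1}` about the round curve enclosing the consecutive holes `a, …, b`. [folklore] -/
inductive PGen where
  | sigma (j : ℕ) (inv : Bool)
  | round (a b : ℕ) (inv : Bool)
  deriving DecidableEq

namespace PGen

/-- Formal inverse of a generator. [folklore] -/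
def inv : PGen → PGen
  | sigma j s => sigma j (!s)
  | round a b s => round a b (!s)

/-- `g.below n`: the generator does not involve the hole `n` (nor any hole beyond it) — the support
condition for stabilising curves. [folklore] -/
def below (n : ℕ) : PGen → Bool
  | sigma j _ => decide (j + 1 < n)
  | round _ b _ => decide (b < n)

/-- The word `x_a x_{a+1} ⋯ x_b ∈ F_n` of the round curve around the holes `a … b` (holes `≥ n` are
ignored). [folklore] -/
def blockWord (n a b : ℕ) : FreeGroup (Fin n) :=
  (((List.finRange n).filter fun i => decide (a ≤ i.val ∧ i.val ≤ b)).map FreeGroup.of).prod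

/-- Arc data of a generator on the disc with `n` holes.  `σⱼ`: `π = (j j+1)`, `uⱼ = xⱼ`, else `1`;
`σⱼ⁻¹`: `π = (j j+1)`, `uⱼ₊₁ = xⱼ₊₁⁻¹`, else `1` (so that `σⱼσⱼ⁻¹ = σⱼ⁻¹σⱼ = 1` on the nose);
`T_[a,b]^{±1}`: `π = 1`, `uᵢ = (x_a ⋯ x_b)^{±1}` for `a ≤ i ≤ b`, else `1`.  A half-twist with
`j + 1 ≥ n` is the identity. [folklore] -/
def data (n : ℕ) : PGen → ArcData n
  | sigma j s =>
      if h : j + 1 < n then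
        { perm := Equiv.swap (⟨j, by omega⟩ : Fin n) ⟨j + 1, h⟩
          u := fun i =>
            if s then (if i = ⟨j + 1, h⟩ then (FreeGroup.of (⟨j + 1, h⟩ : Fin n))⁻¹ else 1)
            else (if i = ⟨j, by omega⟩ then FreeGroup.of (⟨j, by omega⟩ : Fin n) else 1) }
      else ArcData.one
  | round a b s =>
      { perm := 1
        u := fun i => if a ≤ i.val ∧ i.val ≤ b then
          (if s then (blockWord n a b)⁻¹ else blockWord n a b) else 1 }

end PGen

/-- Arc data of a word of generators (`foldr`: the LAST letter acts first, `eval [g₁, g₂] = g₁ ∘ g₂`).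
[folklore] -/
def evalWord (n : ℕ) (g : List PGen) : ArcData n :=
  g.foldr (fun x acc => ArcData.mul (PGen.data n x) acc) ArcData.one

/-- Formal inverse of a word. [folklore] -/
def invWord (g : List PGen) : List PGen :=
  (g.map PGen.inv).reverse

/-- A simple closed curve on the holed disc, presented as the image `g(c_[a,b])` of the round curve
around the holes `a … b` under the word `g` (every essential simple closed curve is of this form:
change of coordinates). [folklore] -/
structure PlanarCurve where
  /-- first hole of the round block -/
  a : ℕ
  /-- last hole of the round block -/
  b : ℕ
  /-- the carrying word -/
  g : List PGen

namespace PlanarCurve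

/-- The Dehn twist about `g(c_[a,b])`, positive (`pos = true`) or negative, as the word
`g · T_[a,b]^{±1} · g⁻¹`. [folklore] -/
def twistWord (c : PlanarCurve) (pos : Bool) : List PGen :=
  c.g ++ [PGen.round c.a c.b (!pos)] ++ invWord c.g

/-- The class `[c] = g_*(x_a ⋯ x_b) ∈ F_n` of the curve (well defined up to conjugacy, which is all
that is used). [folklore] -/
def cls (n : ℕ) (c : PlanarCurve) : FreeGroup (Fin n) :=
  (evalWord n c.g).aut (PGen.blockWord n c.a c.b)

/-- The image curve `h(c)`. [folklore] -/
def image (h : List PGen) (c : PlanarCurve) : PlanarCurve :=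
  ⟨c.a, c.b, h ++ c.g⟩

/-- `c.InRange n`: the syntax of `c` only mentions the holes `0, …, n−1` and its round block is nonempty —
so that `c` denotes the SAME curve on the disc with `n + 1` holes (new hole `n` added away from it).
Words produced by the dictionary are in range; the walk's hypothesis demands it, and stabilisation is
only offered from in-range states (reinterpreting an out-of-range generator one level up would change
its meaning). [folklore] -/
def InRange (n : ℕ) (c : PlanarCurve) : Prop :=
  c.a ≤ c.b ∧ c.b < n ∧ ∀ x ∈ c.g, PGen.below n x = true

end PlanarCurve

/-- A signed letter of an achiral planar word: a curve and a sign (`true` = positive = Lefschetz,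
`false` = negative = achiral critical point). [folklore] -/
abbrev Letter : Type := PlanarCurve × Bool

/-- The twist word `T_c^{±1}` of a signed letter. [folklore] -/
def Letter.twistWord (l : Letter) : List PGen :=
  l.1.twistWord l.2

/-- Monodromy (arc data) of a signed word: the product of its letters' twists, first letter outermost.
[folklore] -/
def monodromy (n : ℕ) (w : List Letter) : ArcData n :=
  evalWord n (w.flatMap Letter.twistWord)

/-- A positive factorisation as a signed word. [folklore] -/
def positiveWord (A : List PlanarCurve) : List Letter :=
  A.map fun c => (c, true)

/-- BLOCK FORM `A · B̄ʳᵉᵛ`: the achiral word of the planar bisection `X_A ∪ X̄_B` — the positive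
factorisation `A` of one half followed by the negative letters of the other half's factorisation `B`
read backwards (total monodromy `1` when `A`, `B` factorise the same class; TRIAGE-r1-1 App. D).
(Baykur arXiv:math/0601396 Thm 5.1.) [folklore] -/
def blockForm (A B : List PlanarCurve) : List Letter :=
  positiveWord A ++ (B.map fun c => (c, false)).reverse

/-- `SeamTrivial n A`: the seam `∂X_A = OB(D_n, T_{a₁} ⋯ T_{aₙ})` of the positive block has TRIVIAL
fundamental group — the balanced arc-data presentation `⟨x₀ … x_{n−1} ∣ uᵢ(T_{a₁} ⋯ T_{aₙ})⟩` presents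
the trivial group (hence, the seam being a closed 3-manifold, `∂X_A ≅ S³` by Perelman). [folklore] -/
def SeamTrivial (n : ℕ) (A : List PlanarCurve) : Prop :=
  Literature.Topology.FourManifolds.BalancedPresentation.PresentsTrivialGroup (monodromy n (positiveWord A)).u

/-- The curves `C` normally generate `F_n`: `π₁` of the 2-handlebody / of the union `X_A ∪ X̄_B` is
trivial. [folklore] -/
def NormallyGenerates (n : ℕ) (C : List PlanarCurve) : Prop :=
  Subgroup.normalClosure {x | x ∈ C.map (PlanarCurve.cls n)} = ⊤

/-- The classes of the curves `A` generate `H₁(D_n) = F_nᵃᵇ ≅ ℤⁿ`: the hole-set matrix of `A` is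
unimodular, `H₁(X_A; ℤ) = 0`. [folklore] -/
def Unimodular (n : ℕ) (A : List PlanarCurve) : Prop :=
  Subgroup.closure {x | x ∈ A.map fun c => Abelianization.of (PlanarCurve.cls n c)} = ⊤

/-- INTEGRAL HOMOTOPY-SPHERE WORD: two positive factorisations `A`, `B` (in-range syntax) of ONE mapping
class of the disc with `n` holes (equal arc data), each of the minimal length `n` (⇔ ℚ-acyclic halves), whose curves
jointly normally generate `F_n` (⇔ `X_A ∪ X̄_B` is a homotopy 4-sphere: `χ = 2`, `H₁ = H₃ = 0`) and whose
hole-set matrices are both unimodular (the integral sector `H₁(X_A;ℤ) = H₁(X_B;ℤ) = 0`; in a homology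
4-sphere `|H₁(X_A)| = |H₁(X_B)|`).  Every such word IS geometric: `Σ(A,B) = X_A ∪ X̄_B` is a smooth
homotopy 4-sphere with a planar common-contact Stein bisection (TRIAGE-r1-2 (S1)). [folklore] -/
structure IsIntegralSphereWord (n : ℕ) (A B : List PlanarCurve) : Prop where
  /-- every curve of `A` and `B` is in-range syntax on `n` holes -/
  inRange : ∀ c ∈ A ++ B, c.InRange n
  /-- `A` has the minimal length `n` -/
  length_left : A.length = n
  /-- `B` has the minimal length `n` -/
  length_right : B.length = n
  /-- `A` and `B` factorise the same mapping class (equal arc data) -/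
  monodromy_eq : monodromy n (positiveWord A) = monodromy n (positiveWord B)
  /-- the curves of `A ++ B` normally generate `F_n` (`π₁ = 1`) -/
  sphere : NormallyGenerates n (A ++ B)
  /-- the hole-set matrix of `A` is unimodular (`H₁(X_A; ℤ) = 0`) -/
  unimodular_left : Unimodular n A
  /-- the hole-set matrix of `B` is unimodular (`H₁(X_B; ℤ) = 0`) -/
  unimodular_right : Unimodular n B

/-- The signed Hurwitz action of the letter `x = (c, ε)` on the letter `y = (d, η)`:
`(T_c^{ε}(d), η)`, the new curve carried by the word `T_c^{ε} · g_d`. (Gompf–Stipsicz §8.2; Baykur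
arXiv:math/0601396 §2.) [folklore] -/
def hurwitzAct (x y : Letter) : Letter :=
  (PlanarCurve.image (Letter.twistWord x) y.1, y.2)

/-- THE MOVES of the walk on states `(n, w)` (`n` holes, achiral word `w`), each re-reading the SAME
closed 4-manifold `X_w ∪ ♮(S¹×B³)`: cyclic rotation; the signed Hurwitz move
`(x, y) ↦ (x y x⁻¹, x)` and its inverse `(x, y) ↦ (y, y⁻¹ x y)` (the only twist-type exchanges
preserving the monodromy product); global conjugation by any mapping class `g` (re-parametrising the
page); and PLANAR STABILISATION — a new hole `n` and the cancelling pair `(γ⁺, γ⁻)` for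
`γ = g(c_[m,n])`, `m ≤ n`, `g` supported off the new hole, a curve meeting the co-core of the new
1-handle once (positive Giroux stabilisation of the seam open book, both halves stabilised), offered
only from in-range states so that the old letters keep their meaning one level up.
(Baykur arXiv:math/0601396 Thm 5.1.) [folklore] -/
inductive Move : ℕ × List Letter → ℕ × List Letter → Prop
  | rotate (n : ℕ) (l : Letter) (w : List Letter) : Move (n, l :: w) (n, w ++ [l])
  | hurwitz (n : ℕ) (pre post : List Letter) (x y : Letter) :
      Move (n, pre ++ x :: y :: post) (n, pre ++ hurwitzAct x y :: x :: post)
  | hurwitzInv (n : ℕ) (pre post : List Letter) (x y : Letter) :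
      Move (n, pre ++ x :: y :: post) (n, pre ++ y :: hurwitzAct (y.1, !y.2) x :: post)
  | conj (n : ℕ) (g : List PGen) (w : List Letter) :
      Move (n, w) (n, w.map fun l => (PlanarCurve.image g l.1, l.2))
  | stabilize (n m : ℕ) (g : List PGen) (w : List Letter) (hm : m ≤ n)
      (hg : ∀ x ∈ g, PGen.below n x = true) (hw : ∀ l ∈ w, l.1.InRange n) :
      Move (n, w) (n + 1, (⟨m, n, g⟩, true) :: (⟨m, n, g⟩, false) :: w)

/-- The ORBIT of the walk: the equivalence relation generated by the moves (so destabilisation is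
allowed too). [folklore] -/
def Reachable : ℕ × List Letter → ℕ × List Letter → Prop :=
  Relation.ReflTransGen fun s t => Move s t ∨ Move t s

/-- `TwistEq n A B`: the two curve lists denote, letter by letter, curves with the SAME positive Dehn
twist on the disc with `n` holes (equal arc data) — semantic equality of the two blocks, independent
of the spelling of the carrying words (lead reshape, cycle 2, on the dictionary worker's advice: the
literal target `A' = B'` is spelling-dependent, since moves only ever PREPEND to carrying words, so an
honest double reached through the walk need not be a syntactic one). [folklore] -/
def TwistEq (n : ℕ) (A B : List PlanarCurve) : Prop :=
  List.Forall₂ (fun c d => evalWord n (c.twistWord true) = evalWord n (d.twistWord true)) A B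

/-! ## Definitional sanity lemmas -/

/-- The empty word acts as the identity mapping class (definitional unfolding of `evalWord`).
[folklore] -/
theorem evalWord_nil (n : ℕ) : evalWord n [] = ArcData.one := rfl

/-- The formal inverse of a generator is an involution. [folklore] -/
theorem PGen.inv_inv (x : PGen) : x.inv.inv = x := by
  cases x <;> simp [PGen.inv]

/-- The formal inverse of a word is an involution: `(g⁻¹)⁻¹ = g` letterwise. [folklore] -/
theorem invWord_invWord (g : List PGen) : invWord (invWord g) = g := by
  simp [invWord, List.map_reverse, Function.comp_def, PGen.inv_inv]

/-- Every state of the walk is reachable from itself. [folklore] -/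
theorem Reachable.refl (s : ℕ × List Letter) : Reachable s s :=
  Relation.ReflTransGen.refl

/-- A single move is a reachability step. [folklore] -/
theorem Move.reachable {s t : ℕ × List Letter} (h : Move s t) : Reachable s t :=
  Relation.ReflTransGen.single (Or.inl h)

/-- Reachability is symmetric: the generating relation `Move s t ∨ Move t s` is symmetric, so every
move (in particular a stabilisation) may be undone. [folklore] -/
theorem Reachable.symm {s t : ℕ × List Letter} (h : Reachable s t) : Reachable t s := by
  unfold Reachable at h ⊢
  induction h with
  | refl => exact Relation.ReflTransGen.refl
  | tail _ hbc ih => exact Relation.ReflTransGen.head hbc.symm ih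

/-- The semantic double target is reflexive: every block is twist-equal to itself. [folklore] -/
theorem TwistEq.refl (n : ℕ) (A : List PlanarCurve) : TwistEq n A A := by
  unfold TwistEq
  induction A with
  | nil => exact List.Forall₂.nil
  | cons c A ih => exact List.Forall₂.cons rfl ih

end Literature.Topology.FourManifolds.PlanarWords

end
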